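import Mathlib
import HarnessLib
import Summits.HubbardSuperconductivity.HubbardSuperconductivity.Theorems.ComplexGFFStiffnessHolomorphicPackageLines
import Literature.MathematicalPhysics.StatisticalMechanics.AbkmPackageShrunkSlots
import Literature.MathematicalPhysics.StatisticalMechanics.AbkmPackageLocalSlots

/-!
# Crux child `TwoKernelSkBound` (stmt-…-27414), line `banach_two_kernel` — the FAR-FIELD reductions:
# local `N`-free two-kernel `S_k` slots ⟹ global slots ([ABKM19] Lemma 12.6 (12.53), `ℓ = 1, 2`)

Route `route-HubbardSuperconductivity-ComplexGFFStiffness`, cruxes stmt-HubbardSuperconductivity-19154 (`HypACumulant`) /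
stmt-…-19155 (`HypALocalTwoPoint`), child stmt-…-27414
(`TwoKernelSkBound := GradientRG.TwoKernelSkBound 4 ∧ GradientRG.F4l2Shrink 4`).  The registered skeleton
`Cruxes/TwoKernelSkBound/Lines/banach_two_kernel.lean` isolates the analytic core of the item in LOCAL form
(`GradientRG.TwoKernelSkBoundLoc` / `F4l2ShrinkLoc` of `Literature/…/AbkmPackageLocalSlots.lean`: the two-kernel
comparison of `S_k^{(q)}` only for tuning parameters at `|·|₁`-distance `≤ T₁`, resp. short parallelograms, with
`N`-free thresholds).  This file proves, for every dimension `d`, that the local forms imply the global slots: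

* `activityNormLE_opS_le` — the zeroth-order bound `‖S_k^{(q)}(u, v)‖_{k+1} ≤ σ(r)·max(‖u‖, c_v)` on the
  Theorem-6.8 ball of a package, `N`-free `σ(r) = sigmaABKM d L R A A_𝒫' r` (fields `lipschitz` + `map_zero` of the
  tree's `isRGStepQ_abkm_of_stepKernelBounds` at the package kernels `𝒞_{1+q,·}`);
* `twoKernelSkBound_of_loc : TwoKernelSkBoundLoc d → TwoKernelSkBound d` — far field at `ℓ = 1`: for
  `|q − q'|₁ > T₁`, Theorem 6.8 twice, size `max(l_T, 2σ(r)/T₁)`;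
* `f4l2Shrink_of_loc : TwoKernelSkBound d → F4l2ShrinkLoc d → F4l2Shrink d` — far field at `ℓ = 2`: a
  parallelogram with a long side is the difference of two first differences along the other side, bounded by
  (F4l) for `P.shrink` twice, size `max(l_TT, 2 l_T/T₂)`;
* `stub_twoKernelSkBound_of_loc`, `stub_f4l2Shrink_of_loc` — the two far-field STUBS of the registered skeleton
  (d = 4), by name and signature.

All proved, no `sorry`; the local bundles enter as explicit hypotheses exactly as in the stubs' signatures
(nothing is assumed as a named fact).  Honest scope: bookkeeping on a rung route (stiffness of a complex Gaussian
gradient field via the [ABKM19] RG); the analytic core (stubs 1/2 of the skeleton) is NOT touched here; nothing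
about superconductivity in the Hubbard model.

## References
* S. Adams, S. Buchholz, R. Kotecký, S. Müller, arXiv:1910.13564, Theorem 6.8, Lemma 12.6 (12.53), Ch. 12 (12.4)
  [AdamsBuchholzKoteckyMuller2019].
-/

noncomputable section

-- `Summit.<Summit>.<Problem>`: single-conjunct summit, the duplicate component is mandated (D-0017).
set_option linter.dupNamespace false

namespace Summit.HubbardSuperconductivity.HubbardSuperconductivity.Theorems.ComplexGFF

open scoped BigOperators
open Literature.MathematicalPhysics.StatisticalMechanics.GradientRG
open Literature.MathematicalPhysics.StatisticalMechanics

variable {d : ℕ}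

/-- **Zeroth-order bound of `S_k^{(q)}` for a package, linear in the state** ([ABKM19] Theorem 6.8 on the
`P.r`-ball, `S_k^{(q)}(0, 0) = 0`): for `q` in the tuning ball, `k + 1 ≤ N`, `‖u‖ ≤ P.r`, `‖v‖_k ≤ c_v ≤ P.r`,
`‖S_k^{(q)}(u, v)‖_{k+1} ≤ σ(r) · max(‖u‖, c_v)` with the `N`-free `σ(r) = sigmaABKM d L R A A_𝒫' r` of the package
(the `lipschitz` and `map_zero` fields of `isRGStepQ_abkm_of_stepKernelBounds` at the package's step kernels). -/
theorem activityNormLE_opS_le (P : PackageData d) [Fact (0 < P.h)] [Fact (0 < P.L)] {N M : ℕ} [NeZero M]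
    (Q : PackageAt P N M) {q : Matrix (Fin d) (Fin d) ℝ} (hq : P.InBall q) {k : ℕ} (hk : k + 1 ≤ N)
    (u : HamSpace ℂ d (fieldWt P.h (P.L : ℝ) d k) ((P.L : ℝ) ^ k) (P.L ^ (d * k)))
    (v : activitySpace Q.normParams k) {cv : ℝ} (hu : ‖u‖ ≤ P.r) (hv : activityNormLE Q.normParams k v cv)
    (hcv : cv ≤ P.r) :
    activityNormLE Q.normParams (k + 1) (Q.opS q k u v)
      (sigmaABKM d P.L P.R P.A P.A𝒫' P.r * max ‖u‖ cv) := by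
  have hPA : 0 < Q.normParams.A := P.A_pos
  have hQn := isSubaddNormBound_activityNormLE Q.normParams hPA
  have hT := isRGStepQ_abkm_of_stepKernelBounds (p := P.pT) (𝒞s := Q.kernels q) P.hd P.hLodd P.hL P.hR2 Q.hM
    P.hp P.hpM P.hMR P.hr₀ Q.hB P.hδ₀ P.hδ₁ P.hh P.hh0 (fun k hk => packageAt_stepKernelBounds P Q hq hk) P.hh2
    P.A𝒫'_nonneg P.hA1 P.hA𝒫A P.hsmall P.hr0 P.hr P.hv P.hωA P.hc3A P.hc2A
  have hlip := hT.lipschitz k (by omega) u 0 v 0 cv 0 cv hu (by rw [norm_zero]; exact P.hr0) hv hcv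
    (hQn.zero k) P.hr0 (by rw [sub_zero]; exact hv)
  rw [hT.map_zero k (by omega), sub_zero, sub_zero] at hlip
  exact hlip

/-- **Far field, first order**: the LOCAL `N`-free two-kernel bound (`F4lLoc` with threshold `T₁ > 0` at every
height) upgrades to the GLOBAL slot (`F4l` at every height) with the `N`-free size `max(l_T, 2σ(r)/T₁)`: for
`|q − q'|₁ > T₁` the difference `S_q(u,v) − S_q'(u,v)` is bounded by Theorem 6.8 twice,
`2σ(r)·max(‖u‖, c_v) ≤ (2σ(r)/T₁)·|q − q'|₁·max(‖u‖, c_v)`. -/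
theorem twoKernelSkBound_of_loc (hloc : TwoKernelSkBoundLoc d) : TwoKernelSkBound d := by
  intro P _ _
  obtain ⟨lT, T₁, hlT0, hT₁, hF⟩ := hloc P
  set σ := sigmaABKM d P.L P.R P.A P.A𝒫' P.r with hσ
  have hσ0 : 0 ≤ σ := sigmaABKM_nonneg P.hLodd.pos P.hA1 P.A𝒫'_nonneg P.hr0
  refine ⟨max lT (2 * σ / T₁), le_max_of_le_left hlT0, fun N M _ Q => ?_⟩
  intro q q' hq hq' k hk u v cv hu hv hcv
  have hPA : 0 < Q.normParams.A := P.A_pos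
  have hQn := isSubaddNormBound_activityNormLE Q.normParams hPA
  have hMt : M = Q.normParams.L ^ k * P.L ^ (N - k) := by
    show M = P.L ^ k * P.L ^ (N - k)
    rw [Q.hM, ← pow_add, Nat.add_sub_cancel' (by omega)]
  have hcv0 : 0 ≤ cv := nonneg_of_weakNormLE hPA hMt P.hLodd.pow P.hLodd.pow hv
  have hm0 : 0 ≤ max ‖u‖ cv := le_max_of_le_left (norm_nonneg _)
  have ht0 : 0 ≤ esum (q - q') := entrySum_nonneg _
  by_cases ht : esum (q - q') ≤ T₁
  · exact hQn.mono (k + 1) _ _ _ (hF N M Q q q' hq hq' ht k hk u v cv hu hv hcv)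
      (mul_le_mul_of_nonneg_right (mul_le_mul_of_nonneg_right (le_max_left _ _) ht0) hm0)
  · have ht' : T₁ < esum (q - q') := lt_of_not_ge ht
    have h1 := activityNormLE_opS_le P Q hq hk u v hu hv hcv
    have h2 := activityNormLE_opS_le P Q hq' hk u v hu hv hcv
    have hsub := hQn.sub (k + 1) _ _ _ _ h1 h2
    refine hQn.mono (k + 1) _ _ _ hsub ?_
    have h3 : 2 * σ ≤ 2 * σ / T₁ * esum (q - q') := by
      rw [div_mul_eq_mul_div, le_div_iff₀ hT₁]
      exact mul_le_mul_of_nonneg_left ht'.le (by positivity)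
    calc σ * max ‖u‖ cv + σ * max ‖u‖ cv = 2 * σ * max ‖u‖ cv := by ring
      _ ≤ 2 * σ / T₁ * esum (q - q') * max ‖u‖ cv := mul_le_mul_of_nonneg_right h3 hm0
      _ ≤ max lT (2 * σ / T₁) * esum (q - q') * max ‖u‖ cv :=
          mul_le_mul_of_nonneg_right (mul_le_mul_of_nonneg_right (le_max_right _ _) ht0) hm0

/-- **Far field, second order**: the global first-order slot (`TwoKernelSkBound`, applied to the shrunk package)
and the LOCAL second-order bound on short parallelograms (`F4l2ShrinkLoc`, threshold `T₂ > 0`) give the GLOBAL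
second-order slot `F4l2Shrink` with the `N`-free size `max(l_TT, 2 l_T/T₂)`: a parallelogram with a long side,
say `|y|₁ > T₂`, is the difference of two first `z`-differences, each `≤ l_T |z|₁ max(‖u‖, c_v)`, and
`2 l_T |z|₁ ≤ (2 l_T/T₂) |y|₁ |z|₁` (symmetrically if `|z|₁ > T₂`). -/
theorem f4l2Shrink_of_loc (hTK : TwoKernelSkBound d) (hloc : F4l2ShrinkLoc d) : F4l2Shrink d := by
  intro P _ _
  obtain ⟨lT, hlT0, hF⟩ := hTK P.shrink
  obtain ⟨lTT, T₂, hlTT0, hT₂, hF2⟩ := hloc P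
  refine ⟨max lTT (2 * lT / T₂), le_max_of_le_left hlTT0, fun N M _ Q => ?_⟩
  intro q y z hq hqy hqz hqyz k hk u v cv hu hv hcv
  have hPA : 0 < Q.normParams.A := P.A_pos
  have hQn := isSubaddNormBound_activityNormLE Q.normParams hPA
  have hMt : M = Q.normParams.L ^ k * P.L ^ (N - k) := by
    show M = P.L ^ k * P.L ^ (N - k)
    rw [Q.hM, ← pow_add, Nat.add_sub_cancel' (by omega)]
  have hcv0 : 0 ≤ cv := nonneg_of_weakNormLE hPA hMt P.hLodd.pow P.hLodd.pow hv
  have hm0 : 0 ≤ max ‖u‖ cv := le_max_of_le_left (norm_nonneg _)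
  have hy0 : 0 ≤ esum y := entrySum_nonneg _
  have hz0 : 0 ≤ esum z := entrySum_nonneg _
  by_cases hyz : esum y ≤ T₂ ∧ esum z ≤ T₂
  · exact hQn.mono (k + 1) _ _ _ (hF2 N M Q q y z hq hqy hqz hqyz hyz.1 hyz.2 k hk u v cv hu hv hcv)
      (mul_le_mul_of_nonneg_right (mul_le_mul_of_nonneg_right
        (mul_le_mul_of_nonneg_right (le_max_left _ _) hy0) hz0) hm0)
  · rcases not_and_or.1 hyz with hy | hz
    · -- long side `y`: two first `z`-differences
      have hy' : T₂ < esum y := lt_of_not_ge hy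
      have h1 := hF N M Q (q + y + z) (q + y) hqyz hqy k hk u v cv hu hv hcv
      have h2 := hF N M Q (q + z) q hqz hq k hk u v cv hu hv hcv
      have e1 : q + y + z - (q + y) = z := by abel
      have e2 : q + z - q = z := by abel
      rw [e1] at h1
      rw [e2] at h2
      have hsub := hQn.sub (k + 1) _ _ _ _ h1 h2
      have e3 : Q.opS (q + y + z) k u v - Q.opS (q + y) k u v - Q.opS (q + z) k u v + Q.opS q k u v =
          (Q.opS (q + y + z) k u v - Q.opS (q + y) k u v) - (Q.opS (q + z) k u v - Q.opS q k u v) := by abel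
      rw [e3]
      refine hQn.mono (k + 1) _ _ _ hsub ?_
      have h3 : 2 * lT ≤ 2 * lT / T₂ * esum y := by
        rw [div_mul_eq_mul_div, le_div_iff₀ hT₂]
        exact mul_le_mul_of_nonneg_left hy'.le (by positivity)
      calc lT * esum z * max ‖u‖ cv + lT * esum z * max ‖u‖ cv = 2 * lT * esum z * max ‖u‖ cv := by ring
        _ ≤ 2 * lT / T₂ * esum y * esum z * max ‖u‖ cv :=
            mul_le_mul_of_nonneg_right (mul_le_mul_of_nonneg_right h3 hz0) hm0
        _ ≤ max lTT (2 * lT / T₂) * esum y * esum z * max ‖u‖ cv :=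
            mul_le_mul_of_nonneg_right (mul_le_mul_of_nonneg_right
              (mul_le_mul_of_nonneg_right (le_max_right _ _) hy0) hz0) hm0
    · -- long side `z`: two first `y`-differences
      have hz' : T₂ < esum z := lt_of_not_ge hz
      have h1 := hF N M Q (q + y + z) (q + z) hqyz hqz k hk u v cv hu hv hcv
      have h2 := hF N M Q (q + y) q hqy hq k hk u v cv hu hv hcv
      have e1 : q + y + z - (q + z) = y := by abel
      have e2 : q + y - q = y := by abel
      rw [e1] at h1
      rw [e2] at h2
      have hsub := hQn.sub (k + 1) _ _ _ _ h1 h2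
      have e3 : Q.opS (q + y + z) k u v - Q.opS (q + y) k u v - Q.opS (q + z) k u v + Q.opS q k u v =
          (Q.opS (q + y + z) k u v - Q.opS (q + z) k u v) - (Q.opS (q + y) k u v - Q.opS q k u v) := by abel
      rw [e3]
      refine hQn.mono (k + 1) _ _ _ hsub ?_
      have h3 : 2 * lT ≤ 2 * lT / T₂ * esum z := by
        rw [div_mul_eq_mul_div, le_div_iff₀ hT₂]
        exact mul_le_mul_of_nonneg_left hz'.le (by positivity)
      calc lT * esum y * max ‖u‖ cv + lT * esum y * max ‖u‖ cv = 2 * lT * esum y * max ‖u‖ cv := by ring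
        _ ≤ 2 * lT / T₂ * esum z * esum y * max ‖u‖ cv :=
            mul_le_mul_of_nonneg_right (mul_le_mul_of_nonneg_right h3 hy0) hm0
        _ = 2 * lT / T₂ * esum y * esum z * max ‖u‖ cv := by ring
        _ ≤ max lTT (2 * lT / T₂) * esum y * esum z * max ‖u‖ cv :=
            mul_le_mul_of_nonneg_right (mul_le_mul_of_nonneg_right
              (mul_le_mul_of_nonneg_right (le_max_right _ _) hy0) hz0) hm0

/-! ## The two far-field stubs of the registered skeleton `banach_two_kernel` (d = 4), BY NAME -/

/-- **Stub 3a of `Cruxes/TwoKernelSkBound/Lines/banach_two_kernel.lean` — `stub_twoKernelSkBound_of_loc`**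
(registered on stmt-HubbardSuperconductivity-27414): the local `N`-free two-kernel slot bundle implies the global
one, `TwoKernelSkBoundLoc 4 → TwoKernelSkBound 4` (far field by Theorem 6.8 twice, `twoKernelSkBound_of_loc`). -/
theorem stub_twoKernelSkBound_of_loc : TwoKernelSkBoundLoc 4 → TwoKernelSkBound 4 :=
  fun h => twoKernelSkBound_of_loc h

/-- **Stub 3b of `Cruxes/TwoKernelSkBound/Lines/banach_two_kernel.lean` — `stub_f4l2Shrink_of_loc`**
(registered on stmt-HubbardSuperconductivity-27414): the global first-order slot and the local second-order bundle
imply the global shrunk second-order slot, `TwoKernelSkBound 4 → F4l2ShrinkLoc 4 → F4l2Shrink 4`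
(long parallelograms by (F4l) for `P.shrink` twice, `f4l2Shrink_of_loc`). -/
theorem stub_f4l2Shrink_of_loc : TwoKernelSkBound 4 → F4l2ShrinkLoc 4 → F4l2Shrink 4 :=
  fun h₁ h₂ => f4l2Shrink_of_loc h₁ h₂

end Summit.HubbardSuperconductivity.HubbardSuperconductivity.Theorems.ComplexGFF

end
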